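import Summits.ResolutionOfSingularities.ResolutionOfSingularities.Theses.PAlteration
import Summits.ResolutionOfSingularities.ResolutionOfSingularities.Theorems.PAlterationPialtTameLU
import Summits.ResolutionOfSingularities.ResolutionOfSingularities.Theorems.PAlterationPialtFrobenius
import Summits.ResolutionOfSingularities.ResolutionOfSingularities.Theorems.PAlterationPialtTameKnownCases
import Summits.ResolutionOfSingularities.ResolutionOfSingularities.Theorems.PAlterationPalterationThesisPialtOfPerfect
import Summits.ResolutionOfSingularities.ResolutionOfSingularities.Theorems.ValuativePatchingReductions
import Literature.AlgebraicGeometry.Resolution.ResolutionLU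
import Literature.AlgebraicGeometry.Resolution.FiniteQuotientSingularityPresentation
import HarnessLib

/-!
# `Pialt` (crux stmt-ResolutionOfSingularities-0555), line `SketchIdeator2` / Card A: the squeeze
# `Temkin2013 ∧ Picover ⇒ local uniformization over perfect fields`, hence both open stubs
# (and the crux) from `Temkin2013 ∧ Picover ∧ TwoModelPatching`

Helper file of the line lead (c1) for the skeleton `radicially-regular-endgame`
(`Cruxes/Pialt/Lines/SketchIdeator2.lean`; `--supports stmt-ResolutionOfSingularities-0555`, it
does not close the item). It fuses the two stub programmes of the line:

* the `stub_tameResolution` programme had reached **tame local uniformization on `K` itself**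
  (`exists_rrModel_le_of_temkin2013`, `PAlterationPialtTameLU.lean`): under Temkin's inseparable
  local uniformization, every valuation ring of a finitely generated `K/k` contains a finitely
  generated affine model `T = B ∩ K` of `K` dominated finitely, radicially and surjectively by
  the REGULAR `Spec B`;
* the `stub_radicialPatching` programme had reached **radicially regular opens of normal
  varieties over perfect fields are resolvable modulo `Picover`**
  (`hasResolution_opens_of_radiciallyRegular_perfectField`, Frobenius domination).

Observations of this file:

* `isIntegrallyClosed_comap_toAlgHom` — `B ∩ K` is integrally closed when `B` is (so the model
  `T` above is NORMAL, `exists_normal_rrModel_le_of_temkin2013`);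
* `isLocallyUniformizable_of_temkin2013_of_picover` — **over a PERFECT field of characteristic
  `p`, `Temkin2013 ∧ Picover` give CLASSICAL (Zariski) local uniformization of every valuation
  of every finitely generated `K/k`, on `K` itself**: `Spec T` is normal, so by Frobenius
  domination (`exists_frobeniusCover_of_finite_universallyInjective`) a scheme `N ≅ Spec T` is a
  finite radicial cover of the regular `Spec B`; `Picover` resolves `N`, hence `Spec T`, and a
  resolution of an affine model contained in `O` uniformizes `O`
  (`exists_affineModel_regular_of_hasResolution`);
* `hasResolution_perfectField_of_temkin2013_picover_twoModelPatching` — hence, by the tree's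
  Zariski–Piltant engine with proper models and ABSOLUTE local uniformization
  (`resolutionOverUpToDim_of_properPatching_of_lu`), **`Temkin2013 ∧ Picover ∧
  ProperModel.TwoModelPatching p` resolve every reduced separated scheme of finite type over
  every perfect field of characteristic `p`**;
* consequently BOTH open stubs of the line follow from the three atoms
  (`stub_tameResolution_of_temkin2013_picover_twoModelPatching`,
  `stub_radicialPatching_of_temkin2013_picover_twoModelPatching`), and so does the crux
  (`pialt_of_temkin2013_picover_twoModelPatching`, via `stub_pialtOfPerfect`).

Census line for the lead: **`Pialt ⇐ Temkin2013 ∧ Picover ∧ (∀ p, TwoModelPatching p)`** —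
`Nagata` and `TwoModelTamePatching` drop out of the line's residual; what is left is one
published theorem (Temkin 2013, Thm. 1.3.2, named fact `Temkin2013`) and two cruxes of the
route (`Picover` = stmt-0554; `ProperModel.TwoModelPatching` = the atom of stmt-0642). Nothing
here proves more than the summit: both atoms are consequences of resolution in characteristic
`p` (`PAlterationPicoverOfSummit`, `ProperModel.twoModelPatching_of_resolutionInChar`).

Sources: M. Temkin, *Inseparable local uniformization*, J. Algebra 373 (2013), Thm. 1.3.2 and
Rem. 1.3.5 (i); O. Zariski, Ann. of Math. 41 (1940) (resolution ⇒ local uniformization, and the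
resolving-system programme); O. Piltant, RACSAM 107 (2013), Prop. 5.1; J. Kollár, Ann. of Math.
145 (1997), Prop. 6.6 (Frobenius domination).
-/

set_option linter.dupNamespace false -- mandated namespace of this single-conjunct summit

noncomputable section

open CategoryTheory CategoryTheory.Limits AlgebraicGeometry TopologicalSpace IsLocalRing
open Literature.AlgebraicGeometry.Resolution

namespace Summit.ResolutionOfSingularities.ResolutionOfSingularities.Theorems.Pialt.RadiciallyRegular

open Summit.ResolutionOfSingularities.ResolutionOfSingularities.Theses.PAlteration (Pialt Picover)

/-! ## `B ∩ K` is normal when `B` is -/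

/-- **`B ∩ K` is integrally closed when `B` is.** For fields `k ⊆ K ⊆ L` of characteristic `p`
with `L/K` purely inseparable and a `k`-subalgebra `B ⊆ L` with `Frac B = L` that is integrally
closed, the `k`-subalgebra `B ∩ K` (`B.comap (K → L)`, fraction field `K` by
`isFractionRing_comap_toAlgHom`) is integrally closed: an `x ∈ K` integral over `B ∩ K` is
integral over `B` in `L`, hence lies in `B`, hence in `B ∩ K`. [folklore] -/
theorem isIntegrallyClosed_comap_toAlgHom {k K L : Type} [Field k] [Field K] [Field L]
    [Algebra k K] [Algebra K L] [Algebra k L] [IsScalarTower k K L] [IsPurelyInseparable K L]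
    (p : ℕ) [Fact p.Prime] [CharP k p] (B : Subalgebra k L) [IsFractionRing B L]
    (hB : IsIntegrallyClosed B) :
    IsIntegrallyClosed (B.comap (IsScalarTower.toAlgHom k K L)) := by
  set f := IsScalarTower.toAlgHom k K L with hf
  set T := B.comap f with hT
  haveI : IsFractionRing T K := isFractionRing_comap_toAlgHom p B
  refine (isIntegrallyClosed_iff K).mpr fun {x} hx => ?_
  -- the ring map `φ : T → B`, `t ↦ f t`, compatible with `f : K → L`
  let φ : T →ₐ[k] B := (f.comp T.val).codRestrict B fun t => t.2
  have hcomp : (algebraMap B L).comp (φ : T →+* B) = (f : K →+* L).comp (algebraMap T K) := by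
    ext t
    rfl
  have hx' : IsIntegral B (f x) := hx.map_of_comp_eq (φ : T →+* B) (f : K →+* L) hcomp
  obtain ⟨b, hb⟩ := hB.algebraMap_eq_of_integral hx'
  refine ⟨⟨x, ?_⟩, rfl⟩
  change f x ∈ B
  rw [← hb]
  exact b.2

/-! ## A normal radicially regular affine model in every valuation ring (Temkin) -/

/-- **Temkin's inseparable local uniformization gives a NORMAL, radicially regular affine model
of `K` inside every valuation ring.** Under the named fact `Temkin2013` (Temkin 2013, Thm. 1.3.2),
for every field `k` of characteristic `p`, finitely generated `K/k` and valuation ring `O ∋ k` of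
`K`, there is a finitely generated `k`-subalgebra `T ⊆ O` with `Frac T = K`, `T` integrally
closed, and `Spec T` dominated by an integral REGULAR scheme through a finite, universally
injective, surjective morphism. This is `exists_rrModel_le_of_temkin2013` with normality of
`T = B ∩ K` recorded (`B = A[1/g]` regular, hence integrally closed,
`isIntegrallyClosed_of_isRegularRing`; `isIntegrallyClosed_comap_toAlgHom`).
[cite: Temkin2013, Thm. 1.3.2] -/
theorem exists_normal_rrModel_le_of_temkin2013 (hT : Temkin2013.{0}) (p : ℕ) [Fact p.Prime]
    (k K : Type) [Field k] [CharP k p] [Field K] [Algebra k K]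
    (hfg : (⊤ : IntermediateField k K).FG) (O : ValuationSubring K)
    (hO : ∀ c : k, algebraMap k K c ∈ O) :
    ∃ T : Subalgebra k K, T.toSubring ≤ O.toSubring ∧ T.FG ∧ IsFractionRing T K ∧
      IsIntegrallyClosed T ∧
      ∃ (W : Scheme.{0}) (h : W ⟶ Spec (.of T)), IsIntegral W ∧ Scheme.IsRegular W ∧
        IsFinite h ∧ UniversallyInjective h ∧ Function.Surjective h.base := by
  obtain ⟨L, _, _, _, _, hfd, hpi, O', hO'O, A, hAO', hAfg, hAfr, hreg⟩ := hT k K hfg O hO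
  haveI := hfd
  haveI := hpi
  haveI := hAfr
  haveI : Algebra.FiniteType k A := A.fg_iff_finiteType.mp hAfg
  -- the centre `𝔭 = 𝔪_{O'} ∩ A` lies in the regular locus of `A`
  let 𝔭 : PrimeSpectrum A :=
    ⟨Ideal.comap (Subring.inclusion hAO') (maximalIdeal O'), Ideal.comap_isPrime _ _⟩
  have h𝔭 : 𝔭 ∈ regularLocus A := hreg
  obtain ⟨g, hg𝔭, hgreg⟩ := exists_not_mem_forall_mem_regularLocus k A 𝔭 h𝔭
  -- `g` is a unit of `O'`
  have hgO' : (g : L) ∈ O' := hAO' g.2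
  have hgmax : (⟨(g : L), hgO'⟩ : O') ∉ maximalIdeal O' := hg𝔭
  have hg0 : (g : L) ≠ 0 := by
    intro h
    apply hgmax
    have : (⟨(g : L), hgO'⟩ : O') = 0 := Subtype.ext h
    rw [this]
    exact zero_mem _
  have hval : O'.valuation (g : L) = 1 := by
    have h1 : O'.valuation ((⟨(g : L), hgO'⟩ : O') : L) ≤ 1 := O'.valuation_le_one _
    have h2 : ¬ O'.valuation ((⟨(g : L), hgO'⟩ : O') : L) < 1 := fun h =>
      hgmax ((O'.valuation_lt_one_iff _).mpr h)
    exact le_antisymm h1 (not_lt.mp h2)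
  -- `B := A[1/g] ⊆ O'`, a finitely generated regular affine model of `L`
  set B : Subalgebra k L := locAway A (g : L) g.2 with hB
  have hBfg : B.FG := fg_locAway hg0 hAfg
  have hBO' : B.toSubring ≤ O'.toSubring := locAway_le_valuationSubring hAO' hval
  haveI hBfr : IsFractionRing B L := isFractionRing_of_le le_locAway hAfr
  haveI hBregRing : IsRegularRing B := by
    letI := (Subalgebra.inclusion
      (le_locAway (B := A) (f := (g : L)) (hf := g.2))).toRingHom.toAlgebra
    haveI : IsLocalization.Away (⟨(g : L), g.2⟩ : A) B := isLocalization_locAway hg0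
    haveI : IsNoetherianRing A := Algebra.FiniteType.isNoetherianRing k A
    exact isRegularRing_of_isLocalization_away (C := A) (g := (⟨(g : L), g.2⟩ : A))
      (fun Q _ hQ => hgreg ⟨Q, ‹_›⟩ hQ) B
  have hBreg : Scheme.IsRegular (Spec (.of B)) := Scheme.isRegular_Spec (.of B)
  have hBn : IsIntegrallyClosed B := isIntegrallyClosed_of_isRegularRing B
  -- `T := B ∩ K ⊆ O' ∩ K = O`
  refine ⟨B.comap (IsScalarTower.toAlgHom k K L), ?_, fg_comap_toAlgHom p B hBfg,
    isFractionRing_comap_toAlgHom p B, isIntegrallyClosed_comap_toAlgHom p B hBn,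
    rr_spec_comap_toAlgHom p B hBfg hBreg⟩
  intro x hx
  have hx' : algebraMap K L x ∈ O' := hBO' (show IsScalarTower.toAlgHom k K L x ∈ B from hx)
  have hx'' : x ∈ O'.comap (algebraMap K L) := hx'
  rw [hO'O] at hx''
  exact hx''

/-! ## Local uniformization over perfect fields from `Temkin2013 ∧ Picover` -/

/-- **Over a perfect field, `Temkin2013 ∧ Picover` give classical local uniformization on `K`
itself.** Let `k` be a PERFECT field of characteristic `p`, `K/k` finitely generated and
`O ∋ k` a valuation ring of `K`. By `exists_normal_rrModel_le_of_temkin2013` some finitely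
generated, normal affine model `T ⊆ O` of `K` is dominated finitely, radicially and
surjectively by an integral regular `W`; as `Spec T` is normal and `k` perfect, Frobenius
domination (`exists_frobeniusCover_of_finite_universallyInjective`) exhibits a scheme
`N ≅ Spec T` as a finite, universally injective, surjective cover of the REGULAR `W`, which the
route's crux `Picover` resolves; a resolution of the affine model `Spec T`, `T ⊆ O`, uniformizes
`O` (`exists_affineModel_regular_of_hasResolution`, valuative criterion). So the per-valuation
purely inseparable extension of Temkin's theorem is absorbed: `IsLocallyUniformizable k K O`.
[cite: Temkin2013, Thm. 1.3.2 and Rem. 1.3.5 (i)] -/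
theorem isLocallyUniformizable_of_temkin2013_of_picover (hT : Temkin2013.{0}) (hPc : Picover)
    {p : ℕ} (hp : p.Prime) (k K : Type) [Field k] [CharP k p] [PerfectField k] [Field K]
    [Algebra k K] (hfg : (⊤ : IntermediateField k K).FG) (O : ValuationSubring K)
    (hO : ∀ c : k, algebraMap k K c ∈ O) : IsLocallyUniformizable k K O := by
  haveI : Fact p.Prime := ⟨hp⟩
  obtain ⟨T, hTO, hTfg, hTfr, hTn, W, h, hW, hreg, hfin, hui, hsurj⟩ :=
    exists_normal_rrModel_le_of_temkin2013 hT p k K hfg O hO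
  haveI := hTfr
  haveI := hW
  haveI := hfin
  haveI := hui
  haveI := hTn
  haveI : Algebra.FiniteType k T := T.fg_iff_finiteType.mp hTfg
  -- `Spec T` as an integral, normal `k`-scheme of finite type
  haveI : IsDomain (CommRingCat.of T) := inferInstanceAs (IsDomain T)
  haveI : IsIntegrallyClosed (CommRingCat.of T) := hTn
  let fT : Spec (.of T) ⟶ Spec (.of k) := Spec.map (CommRingCat.ofHom (algebraMap k T))
  haveI : LocallyOfFiniteType fT :=
    (HasRingHomProperty.Spec_iff (P := @LocallyOfFiniteType)).mpr
      (RingHom.finiteType_algebraMap.mpr ‹_›)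
  have hTn' : ∀ y : Spec (.of T), IsIntegrallyClosed ((Spec (.of T)).presheaf.stalk y) :=
    Literature.AlgebraicGeometry.Motives.isIntegrallyClosed_stalk_Spec (.of T)
  haveI : IsDominant h := ⟨hsurj.denseRange⟩
  -- Frobenius domination: `N ≅ Spec T` covers the regular `W` finitely, radicially, surjectively
  obtain ⟨N, ψ, φ, hNint, hφ, hψfin, hψui, hψsurj⟩ :=
    exists_frobeniusCover_of_finite_universallyInjective hp k W (Spec (.of T)) fT h hTn'
  haveI := hNint
  haveI := hφ
  haveI := hψfin
  haveI := hψui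
  -- `Picover` resolves `N`, hence `Spec T`
  haveI : IsSeparated (h ≫ fT) := inferInstance
  haveI : LocallyOfFiniteType (h ≫ fT) := inferInstance
  haveI : QuasiCompact (h ≫ fT) := inferInstance
  have hres : Scheme.HasResolution N :=
    hPc p hp k W N (h ≫ fT) ψ inferInstance inferInstance inferInstance hW hreg hNint
      hψfin hψui hψsurj
  have hresT : Scheme.HasResolution (Spec (.of T)) := Scheme.HasResolution.of_iso φ hres
  -- a resolution of the affine model `T ⊆ O` uniformizes `O`
  obtain ⟨A', h', hle, hA'fg, hreg'⟩ :=
    exists_affineModel_regular_of_hasResolution O T hTO hTfg hTfr hresT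
  exact ⟨A', h', hA'fg, isFractionRing_of_le hle hTfr, hreg'⟩

/-! ## Resolution over perfect fields, both stubs and the crux from the three atoms -/

/-- **`Temkin2013 ∧ Picover ∧ TwoModelPatching p` resolve every reduced separated scheme of
finite type over a perfect field of characteristic `p`.** Zariski's programme with proper
models and ABSOLUTE local uniformization (`resolutionOverUpToDim_of_properPatching_of_lu`:
finite resolving system by compactness of `Zar(K/k)`, proper models of the uniformizing affine
models, patched two at a time) fed with `isLocallyUniformizable_of_temkin2013_of_picover`.
[cite: Piltant2013, Prop. 5.1 and Cor. 5.7] -/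
theorem hasResolution_perfectField_of_temkin2013_picover_twoModelPatching (hT : Temkin2013.{0})
    (hPc : Picover) {p : ℕ} (hp : p.Prime) (hZ : ProperModel.TwoModelPatching.{0} p)
    (k : Type) [Field k] [CharP k p] [PerfectField k] (X : Scheme.{0}) (f : X ⟶ Spec (.of k))
    [IsSeparated f] [LocallyOfFiniteType f] [QuasiCompact f] [IsReduced X] :
    Scheme.HasResolution X := by
  haveI : CompactSpace X := QuasiCompact.compactSpace_of_compactSpace f
  obtain ⟨d, hd⟩ := exists_topologicalKrullDim_le_of_locallyOfFiniteType f
  exact resolutionOverUpToDim_of_properPatching_of_lu (fun K _ _ _ M₁ M₂ => hZ k K M₁ M₂)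
    (fun K _ _ hKfg O hO => isLocallyUniformizable_of_temkin2013_of_picover hT hPc hp k K hKfg O hO)
    d X f ‹_› ‹_› ‹_› ‹_› hd

/-- **`stub_tameResolution` from the three atoms**: over a perfect field of characteristic `p`,
`Temkin2013 ∧ Picover ∧ TwoModelPatching p` give every integral separated scheme of finite type
a resolution, and a resolution is a tame resolution (`stub_tameResolution_of_hasResolution`).
The binders after `hZ` are those of the registered stub `stub_tameResolution`, verbatim.
[folklore] -/
theorem stub_tameResolution_of_temkin2013_picover_twoModelPatching (hT : Temkin2013.{0})
    (hPc : Picover) (hZ : ∀ p : ℕ, p.Prime → ProperModel.TwoModelPatching.{0} p)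
    (p : ℕ) (hp : p.Prime) (k : Type) [Field k] [CharP k p]
    [PerfectField k] (X : Scheme.{0}) (f : X ⟶ Spec (.of k)) [IsSeparated f]
    [LocallyOfFiniteType f] [QuasiCompact f] [IsIntegral X] :
    ∃ (Z : Scheme.{0}) (π : Z ⟶ X), IsProper π ∧ IsBirational π ∧ IsIntegral Z ∧
      (∀ z : Z, IsIntegrallyClosed (Z.presheaf.stalk z)) ∧
      ∀ z : Z, ∃ U : Z.Opens, z ∈ U ∧ ∃ (W : Scheme.{0}) (h : W ⟶ (U : Scheme.{0})),
        IsIntegral W ∧ Scheme.IsRegular W ∧ IsFinite h ∧ UniversallyInjective h ∧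
          Function.Surjective h.base :=
  stub_tameResolution_of_hasResolution X
    (hasResolution_perfectField_of_temkin2013_picover_twoModelPatching hT hPc hp (hZ p hp) k X f)

/-- **`stub_radicialPatching` from the three atoms** (no `Nagata`, and the local radicial
regularity hypotheses are not even used): over a perfect field of characteristic `p`,
`Temkin2013 ∧ Picover ∧ TwoModelPatching p` resolve the normal variety `Z` outright, and a
resolution is a purely inseparable regular alteration (`pialtConclusion_of_hasResolution`).
The binders after `hZ` are those of the registered stub `stub_radicialPatching`, verbatim
(the two idle hypotheses are kept, `_`-prefixed, so that the term has the stub's type).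
[folklore] -/
theorem stub_radicialPatching_of_temkin2013_picover_twoModelPatching (hT : Temkin2013.{0})
    (hPc : Picover) (hZ : ∀ p : ℕ, p.Prime → ProperModel.TwoModelPatching.{0} p)
    (p : ℕ) (hp : p.Prime) (k : Type) [Field k] [CharP k p]
    [PerfectField k] (Z : Scheme.{0}) (f : Z ⟶ Spec (.of k)) [IsSeparated f]
    [LocallyOfFiniteType f] [QuasiCompact f] [IsIntegral Z]
    (_hN : ∀ z : Z, IsIntegrallyClosed (Z.presheaf.stalk z))
    (_hL : ∀ z : Z, ∃ U : Z.Opens, z ∈ U ∧ ∃ (W : Scheme.{0}) (h : W ⟶ (U : Scheme.{0})),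
      IsIntegral W ∧ Scheme.IsRegular W ∧ IsFinite h ∧ UniversallyInjective h ∧
        Function.Surjective h.base) :
    ∃ (Z' : Scheme.{0}) (g : Z' ⟶ Z), IsProper g ∧ IsIntegral Z' ∧ Scheme.IsRegular Z' ∧
      Function.Surjective g.base ∧ ∃ U : Z.Opens, Dense (U : Set Z) ∧ IsFinite (g ∣_ U) ∧
        UniversallyInjective (g ∣_ U) :=
  pialtConclusion_of_hasResolution Z
    (hasResolution_perfectField_of_temkin2013_picover_twoModelPatching hT hPc hp (hZ p hp) k Z f)

/-- **The crux `Pialt` from `Temkin2013 ∧ Picover ∧ (∀ p, TwoModelPatching p)`.** Perfect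
ground fields suffice for `Pialt` (`PalterationThesis.PerfectTransfer.stub_pialtOfPerfect`:
descent from the perfect closure), and over a perfect field the three atoms resolve every
variety, a resolution being a purely inseparable regular alteration. So, modulo the published
theorem `Temkin2013`, the crux `Pialt` (stmt-0555) of route `pAlteration` is implied by the
route's other crux `Picover` (stmt-0554) together with Piltant's two-model patching of proper
models (the atom of crux `PatchingRel`, stmt-0642). [folklore] -/
theorem pialt_of_temkin2013_picover_twoModelPatching (hT : Temkin2013.{0}) (hPc : Picover)
    (hZ : ∀ p : ℕ, p.Prime → ProperModel.TwoModelPatching.{0} p) : Pialt := by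
  intro p hp k _ _ X f hs hl hq hi
  haveI : Fact p.Prime := ⟨hp⟩
  exact PalterationThesis.PerfectTransfer.stub_pialtOfPerfect p k
    (fun Y g hs' hl' hq' hi' => by
      haveI := hs'; haveI := hl'; haveI := hq'; haveI := hi'
      exact pialtConclusion_of_hasResolution Y
        (hasResolution_perfectField_of_temkin2013_picover_twoModelPatching hT hPc hp (hZ p hp)
          (PerfectClosure k p) Y g))
    X f

end Summit.ResolutionOfSingularities.ResolutionOfSingularities.Theorems.Pialt.RadiciallyRegular

end
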